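import Summits.ResolutionOfSingularities.ResolutionOfSingularities.Theorems.SharpStrataSepExcModelsDefs
import Summits.ResolutionOfSingularities.ResolutionOfSingularities.Theorems.SharpStrataResSepExcIsolatedCore
import HarnessLib

/-!
# Crux `SharpStrata.SepExcModels` (stmt-16828) against route `IsolatedCore`: crux W implies the crux

Line `birth` of crux `SepExcModels` (`Cruxes/SepExcModels/Lines/birth.lean`), lead c1, tool stub (T1,
calibration) `stub_sepExcModels_of_finiteSingularModels`, PROVED:

* `stub_sepExcModels_of_finiteSingularModels` — **`IsolatedCore.FiniteSingularModels → SharpStrata.SepExcModels`**: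
  crux W of route `IsolatedCore` (stmt-ResolutionOfSingularities-18020: every reduced separated finite-type scheme over a
  field of characteristic `p` has a proper birational reduced model with finitely many non-regular points) hands every
  integral separated finite-type `X` over a perfect field an integral proper birational model all of whose points are
  regular or closed (`exists_model_regular_or_isClosed_of_finiteSingularModels`, sibling crux `ResSepExc`); such a point is
  separably exceptional through the first two disjuncts of the route's predicate, so the model is separably exceptional.
* `sepExcModels_of_resolutionOfSingularities'` is NOT restated here (it is the route's support item `Lossless`).

Net for the planners: `SepExcModels` is dominated by W alone (whereas the sibling crux `ResSepExc` needs W ∧ K,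
`resSepExc_of_finiteSingularModels_of_isolatedResolution`); the crux asks strictly less than isolated-singularity models —
bluntness, not regularity, at the non-closed points.
-/

noncomputable section

-- single-problem summit: the doubled namespace component `ResolutionOfSingularities` is forced
set_option linter.dupNamespace false

open CategoryTheory AlgebraicGeometry
open Summit.ResolutionOfSingularities.ResolutionOfSingularities.Theses

namespace Summit.ResolutionOfSingularities.ResolutionOfSingularities.Theorems.SepExcModels.IsolatedCore

/-- **Crux W of route `IsolatedCore` implies the crux `SepExcModels`** (registered tool stub T1 of
line `birth`): take the proper birational integral model of `IsolatedCore.FiniteSingularModels`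
all of whose points are regular or closed (`exists_model_regular_or_isClosed_of_finiteSingularModels`);
a regular point satisfies the first disjunct of `SepExc`, a closed point the second. The hypotheses
`PerfectField k` and the characteristic are idle. [folklore] -/
theorem stub_sepExcModels_of_finiteSingularModels
    (hW : Theses.IsolatedCore.FiniteSingularModels) : Theses.SharpStrata.SepExcModels := by
  intro p hp k _ _ _ X _ f hs hl hq
  haveI := hs; haveI := hl; haveI := hq
  obtain ⟨X', hX', π, hπ, hb, hrc⟩ :=
    SharpStrata.exists_model_regular_or_isClosed_of_finiteSingularModels hW hp k X f
  refine ⟨X', hX', π, hπ, hb, fun ζ => ?_⟩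
  rcases hrc ζ with h | h
  · exact Or.inl h
  · exact Or.inr (Or.inl h)

end Summit.ResolutionOfSingularities.ResolutionOfSingularities.Theorems.SepExcModels.IsolatedCore

end
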